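import Mathlib
import Literature.Barriers.ValiantsHypothesis.AlgebraicNaturalProofs
import Literature.Computability.AlgebraicComplexity.FastSeriesCircuits
import HarnessLib

/-!
# The central-binomial witness in `SmallCircuits ℂ n 2` (crux stmt-ValiantsHypothesis-14610 side,
row 'PrincipalMinors' at the open rung `b = 2`; seat val-np-p5)

**What is proved (unconditional; a helper for the 14610-side rank-method rows; it does NOT close
any item).** The polynomial

  `W_n = Σ_{|m| ≤ n} (∏_l C(2 m_l, m_l)) x^m`

(separable coefficients: products of central binomial coefficients, the moments of the arcsine
law) lies in `SmallCircuits ℂ n 2` for `n ≥ 8192` — degree `≤ n` and fan-in-two size `≤ n²`.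
The companion file `…PrincipalMinorsTwoFull.lean` shows that EVERY principal catalecticant minor
is nonsingular at `W_n` (Gram factorisation `C(2(a+b), a+b) = Σ_t C(2a, a+t) C(2b, b+t)`), moving
the tree's row `principalMinors_three` (exponent `3`, the `n³` truncated-product dynamic programme of
`SeparableCoeffThree`) to the open rung `b = 2`.

**The circuit** (fast power-series arithmetic, all from `Literature/Computability/
AlgebraicComplexity/{JointCircuits, FFTCircuitCost, FastSeriesCircuits}.lean`):
`(1 − 4y) · (Σ_k C(2k,k) y^k)² = 1` (`sum_antidiagonal_centralBinom`, via Vandermonde for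
`Ring.choose (−1/2)`), hence with `ρ = ∏_l Σ_k C(2k,k) x_l^k s^k` and `P(s) = ∏_l (1 − 4 x_l s)`
one has `ρ² P = 1` (`rho_sq_mul_p`) and `W_n = Σ_{d ≤ n} [s^d] ρ` (`coeff_witness`); the circuit
computes the `n + 1` coefficients of `P` by the FFT product tree (`jointlyComputed_prod_linear`,
`≤ 16 K² 2^K` gates, `n ≤ 2^K`), then the first `2^J ≥ n + 1` coefficients of `ρ = P^{-1/2}` by
Newton iteration with FFT multiplication (`jointlyComputed_newton`, `≤ (15 J + 38) 2^{J+1}` gates),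
then their sum (`n` gates): with `K = J = ⌈log₂(n+1)⌉` the total is
`≤ n (32 L² + 60 L + 154) ≤ n²` for `n ≥ 2^{13}` (`complexity_witness_le_sq`).

Honest framing: a `b = 2` hitting-set statement for one classical rank method; nothing here bears
on the dense heart of 14610 or on VP ≠ VNP.

References: von zur Gathen–Gerhard, *Modern Computer Algebra* §8.2, §9.1, §10.1 (FFT, Newton
iteration, product tree); [ForbesShpilkaVolk2018] §1.2 (rank methods are algebraically natural).
-/

-- layout Summits/ValiantsHypothesis/ValiantsHypothesis forces the duplicated namespace component
set_option linter.dupNamespace false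

noncomputable section

namespace Summit.ValiantsHypothesis.ValiantsHypothesis.Theorems.BarrierLever.SuccinctHittingSetsForVP

open Literature.Barriers.ValiantsHypothesis Literature.Computability.AlgebraicComplexity MvPolynomial

namespace CentralBinomialTwo

open Finset

/-! ### §1 The scalar identity `Σ_{i+j=m} C(2i,i) C(2j,j) = 4^m` -/

/-- `(-1/2)(-3/2)⋯(-1/2 - n + 1) = n! · (-1/4)^n · C(2n, n)`. [folklore] -/
theorem descPochhammer_eval_neg_half (n : ℕ) :
    (descPochhammer ℚ n).eval (-(1 / 2 : ℚ)) =
      (n.factorial : ℚ) * ((-1 / 4 : ℚ) ^ n * ((2 * n).choose n : ℚ)) := by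
  induction n with
  | zero => simp
  | succ n ih =>
    have hrec : ((n + 1 : ℕ) : ℚ) * ((2 * (n + 1)).choose (n + 1) : ℚ) =
        2 * (2 * n + 1) * ((2 * n).choose n : ℚ) := by
      have h := Nat.succ_mul_centralBinom_succ n
      rw [Nat.centralBinom_eq_two_mul_choose, Nat.centralBinom_eq_two_mul_choose] at h
      exact_mod_cast h
    rw [descPochhammer_succ_eval, ih, Nat.factorial_succ]
    push_cast at hrec ⊢
    linear_combination ((n.factorial : ℚ) * (-1 / 4 : ℚ) ^ n * (1 / 4 : ℚ)) * hrec

/-- `Ring.choose (-1/2) n = (-1/4)^n C(2n, n)` in `ℚ`. [folklore] -/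
theorem ring_choose_neg_half (n : ℕ) :
    Ring.choose (-(1 / 2 : ℚ)) n = (-1 / 4 : ℚ) ^ n * ((2 * n).choose n : ℚ) := by
  rw [Ring.choose_eq_smul, ← Polynomial.aeval_eq_smeval, Polynomial.aeval_def,
    ← Polynomial.eval_map, descPochhammer_map, descPochhammer_eval_neg_half, smul_eq_mul,
    ← mul_assoc, inv_mul_cancel₀ (by exact_mod_cast (Nat.factorial_ne_zero n)), one_mul]

/-- `(-1)(-2)⋯(-n) = (-1)^n n!`. [folklore] -/
theorem descPochhammer_eval_neg_one (n : ℕ) :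
    (descPochhammer ℚ n).eval (-1 : ℚ) = (-1 : ℚ) ^ n * (n.factorial : ℚ) := by
  induction n with
  | zero => simp
  | succ n ih =>
    rw [descPochhammer_succ_eval, ih, Nat.factorial_succ]
    push_cast
    ring

/-- `Ring.choose (-1) n = (-1)^n` in `ℚ`. [folklore] -/
theorem ring_choose_neg_one (n : ℕ) : Ring.choose (-1 : ℚ) n = (-1 : ℚ) ^ n := by
  rw [Ring.choose_eq_smul, ← Polynomial.aeval_eq_smeval, Polynomial.aeval_def,
    ← Polynomial.eval_map, descPochhammer_map, descPochhammer_eval_neg_one, smul_eq_mul,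
    mul_comm ((-1 : ℚ) ^ n), ← mul_assoc,
    inv_mul_cancel₀ (by exact_mod_cast (Nat.factorial_ne_zero n)), one_mul]

/-- **`Σ_{i+j=m} C(2i, i) C(2j, j) = 4^m`** (the coefficientwise form of
`((1 − 4y)^{-1/2})² = (1 − 4y)^{-1}`), from the Vandermonde identity for `Ring.choose` at
`r = s = −1/2`. [folklore] -/
theorem sum_antidiagonal_centralBinom (m : ℕ) :
    ∑ ij ∈ antidiagonal m, (2 * ij.1).choose ij.1 * (2 * ij.2).choose ij.2 = 4 ^ m := by
  have h := Ring.add_choose_eq m (Commute.all (-(1 / 2 : ℚ)) (-(1 / 2 : ℚ)))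
  rw [show (-(1 / 2 : ℚ)) + -(1 / 2 : ℚ) = -1 by norm_num, ring_choose_neg_one] at h
  simp only [ring_choose_neg_half] at h
  have h' : (-1 : ℚ) ^ m = (-1 / 4 : ℚ) ^ m *
      ((∑ ij ∈ antidiagonal m, (2 * ij.1).choose ij.1 * (2 * ij.2).choose ij.2 : ℕ) : ℚ) := by
    rw [h, Nat.cast_sum, mul_sum]
    refine sum_congr rfl fun ij hij => ?_
    rw [Finset.HasAntidiagonal.mem_antidiagonal] at hij
    rw [← hij, pow_add]
    push_cast
    ring
  have hne : (-1 / 4 : ℚ) ^ m ≠ 0 := pow_ne_zero _ (by norm_num)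
  have key : ((∑ ij ∈ antidiagonal m, (2 * ij.1).choose ij.1 * (2 * ij.2).choose ij.2 : ℕ) : ℚ) =
      ((4 ^ m : ℕ) : ℚ) := by
    apply mul_left_cancel₀ hne
    rw [← h', Nat.cast_pow, ← mul_pow]
    norm_num
  exact_mod_cast key

/-! ### §2 The power series `ρ = ∏_l B(x_l s)` and `P = ∏_l (1 − 4 x_l s)` -/

variable (n : ℕ)

/-- `B_l = Σ_j C(2j, j) x_l^j s^j`, the arcsine-moment series in the variable `x_l`. [folklore] -/
def bser (l : Fin n) : PowerSeries (MvPolynomial (Fin n) ℂ) :=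
  PowerSeries.mk fun j => C (((2 * j).choose j : ℕ) : ℂ) * X l ^ j

/-- The linear factor `1 − 4 x_l s` as a polynomial in `s` over the node ring (in the shape used by
`jointlyComputed_prod_linear`). [folklore] -/
def linPoly (l : Fin n) : Polynomial (MvPolynomial (Fin n) ℂ) :=
  Polynomial.C ((-4 : ℂ) • X l) * Polynomial.X + Polynomial.C 1

/-- `P(s) = ∏_l (1 − 4 x_l s)`. [folklore] -/
def pPoly : Polynomial (MvPolynomial (Fin n) ℂ) := ∏ l, linPoly n l

/-- `ρ = ∏_l B_l`, the separable series whose `s^d x^m` coefficient is `∏_l C(2 m_l, m_l)`.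
[folklore] -/
def rho : PowerSeries (MvPolynomial (Fin n) ℂ) := ∏ l, bser n l

/-- `B_l² = Σ_j 4^j x_l^j s^j`. [folklore] -/
theorem bser_sq (l : Fin n) :
    bser n l * bser n l = PowerSeries.mk fun j => C ((4 : ℂ) ^ j) * X l ^ j := by
  ext j
  rw [PowerSeries.coeff_mul, PowerSeries.coeff_mk]
  simp only [bser, PowerSeries.coeff_mk]
  have hterm : ∀ ij ∈ antidiagonal j,
      C (((2 * ij.1).choose ij.1 : ℕ) : ℂ) * X l ^ ij.1 *
        (C (((2 * ij.2).choose ij.2 : ℕ) : ℂ) * X l ^ ij.2) =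
      C ((((2 * ij.1).choose ij.1 * (2 * ij.2).choose ij.2 : ℕ) : ℂ)) *
        (X l : MvPolynomial (Fin n) ℂ) ^ j := by
    intro ij hij
    rw [Finset.HasAntidiagonal.mem_antidiagonal] at hij
    rw [← hij, pow_add, Nat.cast_mul, C_mul]
    ring
  rw [sum_congr rfl hterm, ← sum_mul, ← map_sum, ← Nat.cast_sum, sum_antidiagonal_centralBinom]
  push_cast
  rfl

/-- `B_l² · (1 − 4 x_l s) = 1`. [folklore] -/
theorem bser_sq_mul_lin (l : Fin n) :
    bser n l * bser n l * (linPoly n l : PowerSeries (MvPolynomial (Fin n) ℂ)) = 1 := by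
  have hlin : (linPoly n l : PowerSeries (MvPolynomial (Fin n) ℂ)) =
      PowerSeries.C ((-4 : ℂ) • X l) * PowerSeries.X + 1 := by
    simp [linPoly, Polynomial.coe_add, Polynomial.coe_mul, Polynomial.coe_C, Polynomial.coe_X]
  rw [hlin, bser_sq, mul_add, mul_one]
  ext j
  rcases j with _ | j
  · simp [← mul_assoc]
  · rw [map_add, ← mul_assoc, PowerSeries.coeff_succ_mul_X, PowerSeries.coeff_mul_C,
      PowerSeries.coeff_mk, PowerSeries.coeff_mk, PowerSeries.coeff_one, if_neg (Nat.succ_ne_zero _),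
      smul_eq_C_mul, map_pow, map_pow, map_neg, pow_succ, pow_succ]
    have h4 : (C (4 : ℂ) : MvPolynomial (Fin n) ℂ) = 4 := map_ofNat _ _
    rw [h4]
    ring

/-- **`ρ² · P = 1`** in the power-series ring over the node ring. [folklore] -/
theorem rho_sq_mul_p :
    rho n * rho n * (pPoly n : PowerSeries (MvPolynomial (Fin n) ℂ)) = 1 := by
  have hP : (pPoly n : PowerSeries (MvPolynomial (Fin n) ℂ)) =
      ∏ l, (linPoly n l : PowerSeries (MvPolynomial (Fin n) ℂ)) := by
    rw [pPoly, ← Polynomial.coeToPowerSeries.ringHom_apply, map_prod]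
    rfl
  rw [hP, rho, ← prod_mul_distrib, ← prod_mul_distrib]
  exact prod_eq_one fun l _ => bser_sq_mul_lin n l

/-- `ρ(0) = 1`. [folklore] -/
theorem coeff_zero_rho : PowerSeries.coeff 0 (rho n) = 1 := by
  rw [PowerSeries.coeff_zero_eq_constantCoeff_apply, rho, map_prod]
  refine prod_eq_one fun l _ => ?_
  rw [bser, PowerSeries.constantCoeff_mk]
  simp

/-- `deg_s P ≤ n`. [folklore] -/
theorem natDegree_pPoly_le : (pPoly n).natDegree ≤ n := by
  rw [pPoly]
  refine (Polynomial.natDegree_prod_le _ _).trans ?_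
  calc ∑ l : Fin n, (linPoly n l).natDegree ≤ ∑ _l : Fin n, 1 :=
        sum_le_sum fun l _ => Polynomial.natDegree_linear_le
    _ = n := by simp

/-- `∏_l C(c_l) x_l^{μ_l} = monomial μ (∏_l c_l)`. [folklore] -/
theorem prod_C_mul_X_pow (μ : Fin n →₀ ℕ) (c : Fin n → ℂ) :
    ∏ l, (C (c l) * X l ^ (μ l) : MvPolynomial (Fin n) ℂ) = monomial μ (∏ l, c l) := by
  rw [prod_mul_distrib, ← map_prod, monomial_eq, Finsupp.prod_fintype _ _ (fun i => pow_zero _)]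

/-- **The `s^d` coefficient of `ρ`**: `Σ_{|μ| = d} (∏_l C(2μ_l, μ_l)) x^μ`. [folklore] -/
theorem coeff_rho (d : ℕ) :
    PowerSeries.coeff d (rho n) = ∑ μ ∈ (univ : Finset (Fin n)).finsuppAntidiag d,
      monomial μ (∏ l, (((2 * μ l).choose (μ l) : ℕ) : ℂ)) := by
  classical
  rw [rho, PowerSeries.coeff_prod]
  refine sum_congr rfl fun μ _ => ?_
  simp only [bser, PowerSeries.coeff_mk]
  exact prod_C_mul_X_pow n μ _

/-- The `x^μ`-coefficient of the `s^d` coefficient of `ρ`. [folklore] -/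
theorem mvcoeff_coeff_rho (d : ℕ) (μ : Fin n →₀ ℕ) :
    MvPolynomial.coeff μ (PowerSeries.coeff d (rho n)) =
      if μ.degree = d then ∏ l, (((2 * μ l).choose (μ l) : ℕ) : ℂ) else 0 := by
  classical
  rw [coeff_rho, coeff_sum]
  simp only [coeff_monomial]
  rw [sum_ite_eq']
  have hmem : μ ∈ (univ : Finset (Fin n)).finsuppAntidiag d ↔ μ.degree = d := by
    rw [mem_finsuppAntidiag, Finsupp.degree_eq_sum]
    simp
  by_cases h : μ.degree = d
  · rw [if_pos (hmem.2 h), if_pos h]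
  · rw [if_neg (fun h' => h (hmem.1 h')), if_neg h]

/-! ### §3 The witness `W_n = Σ_{d ≤ n} [s^d] ρ` -/

/-- **The central-binomial witness** `W_n = Σ_{d ≤ n} [s^d] ρ = Σ_{|m| ≤ n} (∏_l C(2m_l, m_l)) x^m`
(written as the partial sum the circuit computes). [folklore] -/
def witness : MvPolynomial (Fin n) ℂ :=
  ∑ d ∈ range (n + 1), PowerSeries.coeff d (rho n)

/-- **Coefficients of the witness**: `coeff_μ W_n = ∏_l C(2μ_l, μ_l)` for `|μ| ≤ n`, else `0`.
[folklore] -/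
theorem coeff_witness (μ : Fin n →₀ ℕ) :
    MvPolynomial.coeff μ (witness n) =
      if μ.degree ≤ n then ∏ l, (((2 * μ l).choose (μ l) : ℕ) : ℂ) else 0 := by
  rw [witness, coeff_sum]
  simp only [mvcoeff_coeff_rho]
  rw [sum_ite_eq]
  simp only [mem_range, Nat.lt_succ_iff]

/-- The witness has total degree `≤ n`. [folklore] -/
theorem totalDegree_witness_le : (witness n).totalDegree ≤ n := by
  rw [totalDegree]
  refine Finset.sup_le fun μ hμ => ?_
  rw [mem_support_iff, coeff_witness] at hμ
  by_cases h : μ.degree ≤ n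
  · have : (μ.sum fun _ e => e) = μ.degree := rfl
    rw [this]; exact h
  · exact absurd (if_neg h) hμ

/-! ### §4 The circuit: size `≤ n + prodTreeCost K + newtonCost J + n ≤ n²` -/

/-- The roots of unity of the transforms: `ζ κ = exp(π i / 2^{κ-1})`, so `(ζ κ)^{2^{κ-1}} = −1`.
[folklore] -/
def zeta (κ : ℕ) : ℂ := Complex.exp (Real.pi * Complex.I / (2 : ℂ) ^ (κ - 1))

/-- `(ζ κ)^{2^{κ-1}} = −1`. [folklore] -/
theorem zeta_pow (κ : ℕ) (_hκ : κ ≠ 0) : zeta κ ^ 2 ^ (κ - 1) = -1 := by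
  rw [zeta, ← Complex.exp_nat_mul]
  have h2 : ((2 : ℂ)) ^ (κ - 1) ≠ 0 := pow_ne_zero _ two_ne_zero
  rw [show ((2 ^ (κ - 1) : ℕ) : ℂ) * (Real.pi * Complex.I / (2 : ℂ) ^ (κ - 1)) =
    Real.pi * Complex.I by push_cast; field_simp]
  exact Complex.exp_pi_mul_I

/-- **Size of the witness**: `complexity W_n ≤ n + prodTreeCost K + newtonCost J + n` whenever
`n ≤ 2^K` and `n + 1 ≤ 2^J` — leaves `−4 x_l` (`n` gates), FFT product tree for the coefficients
of `P`, Newton iteration for the first `2^J` coefficients of `ρ = P^{-1/2}`, and the final sum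
(`n` gates). [cite: ForbesShpilkaVolk2018, §1.2] -/
theorem complexity_witness_le (K J : ℕ) (hK : n ≤ 2 ^ K) (hJ : n + 1 ≤ 2 ^ J) :
    complexity (witness n) ≤ n + prodTreeCost K + newtonCost J + n := by
  classical
  -- scalars
  have hζ : ∀ κ, κ ≠ 0 → zeta κ ^ 2 ^ (κ - 1) = -1 := zeta_pow
  have ht : ∀ κ, ((2 : ℂ) ^ κ) * ((2 : ℂ) ^ κ)⁻¹ = 1 := fun κ =>
    mul_inv_cancel₀ (pow_ne_zero _ two_ne_zero)
  have hhalf : (2 : ℂ) * (1 / 2) = 1 := by norm_num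
  -- inputs: the variables and the constant `1`
  let u : Fin n ⊕ Unit → MvPolynomial (Fin n) ℂ := Sum.elim (fun l => X l) (fun _ => 1)
  have hu : JointlyComputed u 0 := jointlyComputed_of_inputs u (by
    rintro (l | x)
    · exact Or.inl ⟨l, rfl⟩
    · exact Or.inr ⟨1, by simp [u]⟩)
  -- the leaves `-4 • x_l`
  have h1 := hu.extend_smul (κ := Fin n) (fun _ => (-4 : ℂ)) (fun l => Sum.inl l)
  rw [Fintype.card_fin, Nat.zero_add] at h1
  -- the coefficients of `P` by the product tree
  have h2 := jointlyComputed_prod_linear zeta (fun κ => ((2 : ℂ) ^ κ)⁻¹) hζ ht h1 hK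
    (fun _ => (1 : MvPolynomial (Fin n) ℂ)) (fun l => (-4 : ℂ) • X l)
    (fun _ => Sum.inl (Sum.inr ())) (fun l => Sum.inr l) (fun l => rfl) (fun l => rfl)
  -- the first `2^J` coefficients of `ρ` by Newton iteration
  have hPc : ∀ j, (n : ℕ) < j → PowerSeries.coeff j
      (pPoly n : PowerSeries (MvPolynomial (Fin n) ℂ)) = 0 := fun j hj => by
    rw [Polynomial.coeff_coe]
    exact Polynomial.coeff_eq_zero_of_natDegree_lt ((natDegree_pPoly_le n).trans_lt hj)
  have h3 := jointlyComputed_newton zeta (fun κ => ((2 : ℂ) ^ κ)⁻¹) hζ ht (1 / 2) hhalf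
    (rho n) (pPoly n : PowerSeries (MvPolynomial (Fin n) ℂ)) (rho_sq_mul_p n) (coeff_zero_rho n)
    n hPc J _ _ (fun j => Sum.inr j) h2 (fun j => by
      simp only [Sum.elim_inr, Polynomial.coeff_coe]
      rfl)
  -- the final sum
  have h4 := jointlyComputed_sum h3 (fun d => PowerSeries.coeff d (rho n)) n
    (fun d => Sum.inr ⟨d, by omega⟩) (fun d => rfl)
  have := h4.complexity_le (Sum.inr ())
  simpa [witness, Nat.add_assoc] using this

/-- `32 L² + 60 L + 154 ≤ 2^{L-1}` for `L ≥ 14`. [folklore] -/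
theorem quad_le_two_pow (L : ℕ) (hL : 14 ≤ L) : 32 * L ^ 2 + 60 * L + 154 ≤ 2 ^ (L - 1) := by
  induction L, hL using Nat.le_induction with
  | base => norm_num
  | succ L hL ih =>
    have h1 : 64 * L + 92 ≤ 32 * L ^ 2 + 60 * L + 154 := by nlinarith [hL]
    have h2 : 32 * (L + 1) ^ 2 + 60 * (L + 1) + 154 =
        (32 * L ^ 2 + 60 * L + 154) + (64 * L + 92) := by ring
    have h3 : 2 ^ (L + 1 - 1) = 2 ^ (L - 1) * 2 := by
      rw [show L + 1 - 1 = (L - 1) + 1 by omega, pow_succ]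
    rw [h2, h3]
    omega

/-- **Size of the witness at the open rung**: `complexity W_n ≤ n²` for `n ≥ 8192 = 2^{13}`
(take `K = J = ⌈log₂(n+1)⌉ =: L ≥ 14`: `2^L ≤ 2n`, total `≤ n (32L² + 60L + 154) ≤ n 2^{L-1} ≤ n²`).
[cite: ForbesShpilkaVolk2018, §1.2] -/
theorem complexity_witness_le_sq (hn : 8192 ≤ n) : complexity (witness n) ≤ n ^ 2 := by
  set L := Nat.clog 2 (n + 1) with hLdef
  have hpow : n + 1 ≤ 2 ^ L := Nat.le_pow_clog one_lt_two _
  have hlt : 2 ^ (L - 1) < n + 1 := by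
    have := Nat.pow_pred_clog_lt_self one_lt_two (x := n + 1) (by omega)
    simpa [Nat.pred_eq_sub_one] using this
  have hL14 : 14 ≤ L := by
    by_contra h
    have h13 : L ≤ 13 := by omega
    have : 2 ^ L ≤ 2 ^ 13 := Nat.pow_le_pow_right (by norm_num) h13
    omega
  have h2L : 2 ^ L = 2 * 2 ^ (L - 1) := by
    rw [← pow_succ']; congr 1; omega
  have hmain := complexity_witness_le n L L (by omega) hpow
  have hT := prodTreeCost_le L
  have hN := newtonCost_le L
  have hq := quad_le_two_pow L hL14
  have h2L1 : 2 ^ (L - 1) ≤ n := by omega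
  -- everything in terms of `t = 2^(L-1) ≤ n`
  rw [h2L] at hT
  rw [pow_succ, h2L] at hN
  have hL1 : L ≤ 2 ^ (L - 1) := by
    have := Nat.lt_two_pow_self (n := L - 1); omega
  nlinarith [hmain, hT, hN, hq, h2L1, hL1, Nat.zero_le L, Nat.zero_le (2 ^ (L - 1))]

/-- **The witness is a small circuit at exponent 2**: `W_n ∈ SmallCircuits ℂ n 2` for `n ≥ 8192`.
[cite: ForbesShpilkaVolk2018, §1.2] -/
theorem witness_mem_smallCircuits (hn : 8192 ≤ n) : witness n ∈ SmallCircuits ℂ n 2 :=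
  ⟨totalDegree_witness_le n, complexity_witness_le_sq n hn⟩

end CentralBinomialTwo

end Summit.ValiantsHypothesis.ValiantsHypothesis.Theorems.BarrierLever.SuccinctHittingSetsForVP

end
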